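import Mathlib
import Literature.Computability.AlgebraicComplexity.SimultaneousDoubleProduct
import Summits.MatrixMultiplication.MatrixMultiplication.Theses.FourierTwoFamiliesModP

/-!
# Crux-triage (r1, triager 1) machine-checked note for `PrimeLogDecay` (stmt-MatrixMultiplication-14310)

`sum_card_mul_card_le_of_common_diff` — the COMMON-DIFFERENCE-SET WALL: in an SDPP family whose
A-blocks all have the same difference set `A i - A i = A i₀ - A i₀`, the sets `A i₀ + B i` are
pairwise disjoint of size `|A i₀|·|B i|`, so `∑ i |A i₀|·|B i| ≤ |G|`; balanced: `n·s² ≤ |G|`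
(the gen-1 "wall", density `≤ 1/s`).  This generalises the disprover's
`card_translateClass_mul_le` (translates ⇒ common difference set) and confirms the claim of card
`forced-refactorization-rigidity` ("common Fourier-modulus profile ⇒ wall n ≤ p/s²": common
`|𝟙̂_{A i}|` ⇒ common autocorrelation ⇒ common support `A i - A i`) under a weaker, purely
combinatorial hypothesis.  Consequence for every card: a counterexample / near-extremiser beyond the
wall must use A-blocks with at least `ρ s` distinct difference sets `A i - A i` on average
(pigeonhole over difference-set classes).
-/

open scoped Pointwise

set_option linter.dupNamespace false

namespace Summit.MatrixMultiplication.MatrixMultiplication.Cruxes.PrimeLogDecay.TriageOne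

variable {G : Type*} [AddCommGroup G] [Fintype G] [DecidableEq G] {n : ℕ}

/-- Common A-difference set ⟹ wall: `∑ i |A i₀|·|B i| ≤ |G|`. -/
theorem sum_card_mul_card_le_of_common_diff {A B : Fin n → Finset G}
    (h : Literature.Computability.AlgebraicComplexity.IsSDPP A B) (i₀ : Fin n)
    (hE : ∀ i, A i - A i = A i₀ - A i₀) :
    ∑ i, (A i₀).card * (B i).card ≤ Fintype.card G := by
  classical
  let S : Finset (Σ _ : Fin n, G × G) := Finset.univ.sigma fun i => A i₀ ×ˢ B i
  let f : (Σ _ : Fin n, G × G) → G := fun x => x.2.1 + x.2.2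
  have hinj : Set.InjOn f ↑S := by
    rintro ⟨i, a, b⟩ hx ⟨k, a', b'⟩ hy hxy
    simp only [S, Finset.coe_sigma, Set.mem_sigma_iff, Finset.mem_coe, Finset.mem_univ, true_and,
      Finset.mem_product] at hx hy
    obtain ⟨ha, hb⟩ := hx
    obtain ⟨ha', hb'⟩ := hy
    simp only [f] at hxy
    -- a - a' ∈ A i₀ - A i₀ = A i - A i
    have hmem : a - a' ∈ A i - A i := by
      rw [hE i]; exact Finset.sub_mem_sub ha ha'
    obtain ⟨c, hc, c', hc', hcc⟩ := Finset.mem_sub.1 hmem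
    have e0 : (c - c') + (b - b') = 0 := by
      rw [hcc]
      have : a + b - (a' + b') = 0 := by rw [hxy, sub_self]
      calc a - a' + (b - b') = a + b - (a' + b') := by abel
        _ = 0 := this
    -- (X) with indices (i, i, k) forces i = k
    have hik : i = k := h.2 i i k c hc c' hc' b hb b' hb' e0
    subst hik
    -- (W) for block i forces c = c', b = b'
    obtain ⟨hcc', hbb'⟩ := h.1 i c hc c' hc' b hb b' hb' e0
    have haa' : a = a' := by
      have : a - a' = 0 := by rw [← hcc, hcc', sub_self]
      exact sub_eq_zero.1 this
    subst haa'; subst hbb'; rfl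
  have hmaps : ∀ x ∈ S, f x ∈ (Finset.univ : Finset G) := fun _ _ => Finset.mem_univ _
  have := Finset.card_le_card_of_injOn f hmaps hinj
  simpa [S, Finset.card_sigma, Finset.card_product, Finset.card_univ] using this

/-- Balanced corollary in the route's own clauses: common A-difference set ⟹ `n·s² ≤ |G|`. -/
theorem wall_of_common_diff {A B : Fin n → Finset G} {s : ℕ}
    (hcard : ∀ i : Fin n, (A i).card = s ∧ (B i).card = s)
    (hW : ∀ i : Fin n, ∀ a ∈ A i, ∀ a' ∈ A i, ∀ b ∈ B i, ∀ b' ∈ B i,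
      (a - a') + (b - b') = 0 → a = a' ∧ b = b')
    (hX : ∀ i j k : Fin n, ∀ a ∈ A i, ∀ a' ∈ A j, ∀ b ∈ B j, ∀ b' ∈ B k,
      (a - a') + (b - b') = 0 → i = k)
    (i₀ : Fin n) (hE : ∀ i, A i - A i = A i₀ - A i₀) :
    n * s ^ 2 ≤ Fintype.card G := by
  have h : Literature.Computability.AlgebraicComplexity.IsSDPP A B := ⟨hW, hX⟩
  have key := sum_card_mul_card_le_of_common_diff h i₀ hE
  have : ∑ i : Fin n, (A i₀).card * (B i).card = n * s ^ 2 := by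
    simp [(hcard i₀).1, fun i => (hcard i).2, Finset.sum_const, Finset.card_univ, sq]
  omega

end Summit.MatrixMultiplication.MatrixMultiplication.Cruxes.PrimeLogDecay.TriageOne
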